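import Literature.NumberTheory.Sieve.LiouvilleSiftedClasses
import Literature.NumberTheory.Sieve.MaierSieveOscillation
import HarnessLib

/-!
# A segment of a progression sifted by an arbitrary set of primes, and the window–parity
# oscillation of a shifted sifted interval (Friedlander–Granville's "poorly sifted interval")

Topic `Literature/NumberTheory/Sieve`. Everything in this file is PROVED (theorems and elementary
bookkeeping definitions only; no named facts).

Friedlander–Granville (*Limitations to the equi-distribution of primes III*, Compositio Math. 81
(1992), §3 Proposition 1) need, for the columns of their Maier matrix, an interval `(h, h + y]`
and a count `G(h) = #{1 ≤ r ≤ y : (r, a) = 1, (r + h, P) = 1}` which deviates from the "expected"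
`y · ∏_{p ∣ a}(1 − 1/p) · ∏_{p ∣ P}(1 − 1/p)` by a definite factor (`e^γ ω(M) ≠ 1`, Buchstab). We
prove a version of this with the parity device of the tree's `MaierSieveOscillation.lean`
(Soundararajan 2007, Lecture 3, Exercise 11) in place of Buchstab's function: the sieving set is
`U ∪ S` where `S` is a "window" of primes all `> w` with `y + 1 ≤ w^{k+1}` (so that Legendre's
expansion over `S` truncates EXACTLY after `k`-fold products and the deviation has the sign
`(−1)^k`), while the remaining primes (`T`: the small prime factors of `a`, excluded class `0`;
`U`: further small primes, excluded class `−1`) are handled by the Fundamental Lemma of sieve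
theory (tree: `SieveSequence.fundamental_lemma_uniform_holds`, Friedlander–Iwaniec Cor. 6.10)
through a Chinese-remainder shift which turns all conditions into "no prime of `T ∪ U` divides
`m`" on a segment.

* `apSiftedCount X₁ y e c Ps = #{X₁ < m ≤ X₁ + y : m ≡ c (mod e), p ∤ m ∀ p ∈ Ps}` and
  `abs_apSiftedCount_sub_le` — **a segment of a progression sifted by an arbitrary finite set of
  primes** `Ps` below `z`, none dividing `e`: with `V = ∏_{p∈Ps}(1 − 1/p)`,
  `|apSiftedCount − (y/e)V| ≤ C (y/e) V e^{−log D/log z} + D` for `2 ≤ z ≤ D` (absolute `C`).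
* `shiftedSiftedCount y T U = #{1 ≤ r ≤ y : p ∤ r ∀ p ∈ T, p ∤ r+1 ∀ p ∈ U}` and
  `abs_shiftedSiftedCount_window_sub_le` — **the window–parity estimate**: for disjoint finite sets
  of primes `T, U` (below `z`) and `S` (at least `z`, all `> w ≥ 1`, `y + 1 ≤ w^{k+1}`),
  `|G − y V (W(S) + (−1)^k g_k(S))| ≤ C e^{−log D/log z} y V ∏_{p∈S}(1 + 1/p) + (k+1)(#S+1)^k D`,
  `G = shiftedSiftedCount y T (U ∪ S)`, `V = ∏_{T∪U}(1−1/p)`, `W(S) = ∏_S(1−1/p)`, `g_k` the signed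
  Legendre tail of `MaierSieveOscillation.lean`; whence `G ≥ yVW(1 + e_{k+1}(S)) − Err` for even
  `k` and `G ≤ yVW(1 − e_{k+1}(S)) + Err` for odd `k` (`shiftedSiftedCount_window_ge_of_even`,
  `…_le_of_odd`).

## References

* J. Friedlander, A. Granville, Compositio Math. 81 (1992), §3 (Proposition 1, Lemma 2, (3.2))
  (`FriedlanderGranville1992`).
* K. Soundararajan, *The distribution of prime numbers* (2007), Lecture 3, Exercise 11
  (`Soundararajan2007Distribution`).
* J. Friedlander, H. Iwaniec, *Opera de Cribro* (2010), Cor. 6.10 (`FriedlanderIwaniecOpera2010`).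
-/

noncomputable section

open Finset
open scoped ArithmeticFunction.Moebius

namespace Literature.NumberTheory.Sieve.ShiftedWindowSieve

open LiouvilleSifted MaierMatrix

/-! ## A segment of a progression sifted by an arbitrary finite set of primes -/

/-- `apSiftedCount X₁ y e c Ps = #{X₁ < m ≤ X₁ + y : m ≡ c (mod e) and p ∤ m for every p ∈ Ps}`.
[cite: FriedlanderGranville1992, §3 Lemma 2 (the quantity estimated)] -/
def apSiftedCount (X₁ y e c : ℕ) (Ps : Finset ℕ) : ℕ :=
  #{m ∈ Ioc X₁ (X₁ + y) | m ≡ c [MOD e] ∧ ∀ p ∈ Ps, ¬ p ∣ m}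

/-- The sieve sequence of the progression segment, sifted along `primePart Ps m`:
`a_n = #{X₁ < m ≤ X₁ + y : m ≡ c (e), primePart Ps m = n}`, `X = y/e`, density `psRecip Ps`. [folklore] -/
def apSeq (X₁ y e c : ℕ) (Ps : Finset ℕ) : SieveSequence where
  a n := #((Ioc X₁ (X₁ + y)).filter fun m : ℕ => m ≡ c [MOD e] ∧ primePart Ps m = n)
  a_nonneg _ := Nat.cast_nonneg _
  size _ := (y : ℝ) / e
  density := psRecip Ps
  density_mult := isMultiplicative_psRecip Ps

variable {Ps : Finset ℕ}

/-- The sifted sum of `apSeq` at height `X₁ + y` is `apSiftedCount`. [folklore] -/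
theorem apSeq_sifted (hPs : ∀ p ∈ Ps, p.Prime) {z : ℝ} (hPz : ∀ p ∈ Ps, (p : ℝ) < z)
    (X₁ y e c : ℕ) :
    (apSeq X₁ y e c Ps).sifted ((X₁ + y : ℕ) : ℝ) (primesProdBelow z) = apSiftedCount X₁ y e c Ps := by
  rw [SieveSequence.sifted, Nat.floor_natCast]
  change ∑ k ∈ (Ioc 0 (X₁ + y)).filter (fun k : ℕ => k.Coprime (primesProdBelow z)),
    (#((Ioc X₁ (X₁ + y)).filter fun m : ℕ => m ≡ c [MOD e] ∧ primePart Ps m = k) : ℝ) = _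
  have hrw : ∀ k : ℕ, ((Ioc X₁ (X₁ + y)).filter fun m : ℕ => m ≡ c [MOD e] ∧ primePart Ps m = k) =
      (((Ioc X₁ (X₁ + y)).filter fun m : ℕ => m ≡ c [MOD e]).filter fun m => primePart Ps m = k) := by
    intro k; rw [filter_filter]
  simp_rw [hrw]
  rw [sum_card_filter_eq, apSiftedCount, filter_filter]
  congr 2
  ext m
  simp only [mem_filter, mem_Ioc]
  constructor
  · rintro ⟨hm, hc, -, hcop⟩
    exact ⟨hm, hc, (coprime_primePart_primesProdBelow_iff hPs hPz m).1 hcop⟩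
  · rintro ⟨hm, hc, hall⟩
    refine ⟨hm, hc, ⟨primePart_pos hPs m, ?_⟩, (coprime_primePart_primesProdBelow_iff hPs hPz m).2 hall⟩
    exact (primePart_le hPs (by omega)).trans hm.2

/-- `A_d = #{m : m ≡ c (e), d ∣ primePart Ps m}` for `apSeq`. [folklore] -/
theorem apSeq_congrSum (hPs : ∀ p ∈ Ps, p.Prime) (X₁ y e c d : ℕ) :
    (apSeq X₁ y e c Ps).congrSum d ((X₁ + y : ℕ) : ℝ) =
      #((Ioc X₁ (X₁ + y)).filter fun m : ℕ => m ≡ c [MOD e] ∧ d ∣ primePart Ps m) := by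
  rw [SieveSequence.congrSum, Nat.floor_natCast]
  change ∑ k ∈ (Ioc 0 (X₁ + y)).filter (d ∣ ·),
    (#((Ioc X₁ (X₁ + y)).filter fun m : ℕ => m ≡ c [MOD e] ∧ primePart Ps m = k) : ℝ) = _
  have hrw : ∀ k : ℕ, ((Ioc X₁ (X₁ + y)).filter fun m : ℕ => m ≡ c [MOD e] ∧ primePart Ps m = k) =
      (((Ioc X₁ (X₁ + y)).filter fun m : ℕ => m ≡ c [MOD e]).filter fun m => primePart Ps m = k) := by
    intro k; rw [filter_filter]
  simp_rw [hrw]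
  rw [sum_card_filter_eq, filter_filter]
  congr 2
  ext m
  simp only [mem_filter, mem_Ioc]
  constructor
  · rintro ⟨hm, hc, -, hd⟩; exact ⟨hm, hc, hd⟩
  · rintro ⟨hm, hc, hd⟩
    refine ⟨hm, hc, ⟨primePart_pos hPs m, ?_⟩, hd⟩
    exact (primePart_le hPs (by omega)).trans hm.2

/-- The remainders of `apSeq` are at most `1` in modulus on the squarefree `d`: if some prime of `d`
is outside `Ps` both `A_d` and `g(d)` vanish; otherwise `d ∣ primePart Ps m ↔ d ∣ m`, the two
congruences `m ≡ c (e)`, `d ∣ m` are one class modulo `e d` (`(e, d) = 1` because no prime of `Ps`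
divides `e`), and a class is counted in a segment of length `y` up to an error `≤ 1`. [folklore] -/
theorem abs_apSeq_remainder_le (hPs : ∀ p ∈ Ps, p.Prime) {e : ℕ} (he : 0 < e)
    (hPe : ∀ p ∈ Ps, ¬ p ∣ e) (X₁ y c : ℕ) {d : ℕ} (hd : Squarefree d) :
    |(apSeq X₁ y e c Ps).remainder d ((X₁ + y : ℕ) : ℝ)| ≤ 1 := by
  rw [SieveSequence.remainder, apSeq_congrSum hPs]
  change |(#((Ioc X₁ (X₁ + y)).filter fun m : ℕ => m ≡ c [MOD e] ∧ d ∣ primePart Ps m) : ℝ) -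
    psRecip Ps d * ((y : ℝ) / e)| ≤ 1
  have hd0 : d ≠ 0 := hd.ne_zero
  by_cases hall : ∀ p ∈ d.primeFactors, p ∈ Ps
  · -- all primes of `d` in `Ps`
    have hg : psRecip Ps d = ((d : ℝ))⁻¹ := by rw [psRecip_apply, if_pos ⟨hd0, hall⟩]
    have hset : ((Ioc X₁ (X₁ + y)).filter fun m : ℕ => m ≡ c [MOD e] ∧ d ∣ primePart Ps m) =
        (Ioc X₁ (X₁ + y)).filter fun m : ℕ => m ≡ c [MOD e] ∧ d ∣ m := by
      refine filter_congr fun m _ => ?_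
      rw [dvd_primePart_iff_of_squarefree hPs hd]
      exact ⟨fun ⟨h1, h2⟩ => ⟨h1, h2.2⟩, fun ⟨h1, h2⟩ => ⟨h1, hall, h2⟩⟩
    have hed : e.Coprime d := by
      refine Nat.Coprime.symm (Nat.coprime_of_dvd fun p hp hpd hpe => ?_)
      exact hPe p (hall p (Nat.mem_primeFactors.2 ⟨hp, hpd, hd0⟩)) hpe
    rw [hset, BFI.filter_modEq_and_dvd_eq hed c, hg]
    have h1 := BFI.abs_card_Ioc_filter_modEq_sub_le (Nat.mul_pos he (Nat.pos_of_ne_zero hd0))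
      (Nat.chineseRemainder hed c 0 : ℕ) (Nat.le_add_right X₁ y)
    have heq : ((d : ℝ))⁻¹ * ((y : ℝ) / e) = (((X₁ + y : ℕ) : ℝ) - X₁) / ((e * d : ℕ) : ℝ) := by
      push_cast
      field_simp
      ring
    rw [heq]
    exact h1
  · -- some prime of `d` outside `Ps`: everything vanishes
    have hg : psRecip Ps d = 0 := by rw [psRecip_apply, if_neg (fun h => hall h.2)]
    push Not at hall
    obtain ⟨p, hp, hpP⟩ := hall
    have hempty : ((Ioc X₁ (X₁ + y)).filter fun m : ℕ => m ≡ c [MOD e] ∧ d ∣ primePart Ps m) = ∅ := by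
      refine filter_eq_empty_iff.2 fun m _ ⟨_, hdm⟩ => hpP ?_
      have hpp := Nat.prime_of_mem_primeFactors hp
      exact ((prime_dvd_primePart_iff hPs hpp).1 ((Nat.dvd_of_mem_primeFactors hp).trans hdm)).1
    rw [hempty, hg]
    simp

/-- The density product of `apSeq` over the primes below `z ⊇ Ps` is `W(Ps) = ∏_{p∈Ps}(1 − 1/p)`. [folklore] -/
theorem apSeq_densityProduct (hPs : ∀ p ∈ Ps, p.Prime) {z : ℝ} (hPz : ∀ p ∈ Ps, (p : ℝ) < z)
    (X₁ y e c : ℕ) :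
    (apSeq X₁ y e c Ps).densityProduct (primesProdBelow z) = sieveDensity Ps := by
  rw [SieveSequence.densityProduct, primeFactors_primesProdBelow, sieveDensity]
  change ∏ p ∈ Nat.primesBelow ⌈z⌉₊, (1 - psRecip Ps p) = ∏ p ∈ Ps, (1 - (p : ℝ)⁻¹)
  have hsub : Ps ⊆ Nat.primesBelow ⌈z⌉₊ := fun p hp =>
    Nat.mem_primesBelow.2 ⟨Nat.lt_ceil.2 (hPz p hp), hPs p hp⟩
  rw [← prod_subset hsub]
  · refine prod_congr rfl fun p hp => ?_
    have hpp := hPs p hp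
    rw [psRecip_apply, if_pos]
    refine ⟨hpp.ne_zero, fun q hq => ?_⟩
    rw [hpp.primeFactors, mem_singleton] at hq
    rw [hq]; exact hp
  · intro p hpz hpn
    have hpp := Nat.prime_of_mem_primesBelow hpz
    rw [psRecip_apply, if_neg, sub_zero]
    rintro ⟨-, h⟩
    exact hpn (h p (by rw [hpp.primeFactors]; exact mem_singleton_self p))

/-- **A segment of a progression sifted by an arbitrary finite set of primes** (Fundamental Lemma;
Friedlander–Granville 1992, §3 (3.2) and Lemma 2, in a two-sided form with the tree's constant):
there is an absolute `C > 0` such that for every finite set `Ps` of primes below `z`, every modulus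
`e ≥ 1` divisible by no prime of `Ps`, every class `c`, all `X₁, y` and all `2 ≤ z ≤ D`,
`|#{X₁ < m ≤ X₁+y : m ≡ c (e), p ∤ m ∀ p ∈ Ps} − (y/e) ∏_{p∈Ps}(1 − 1/p)|
   ≤ C (y/e) ∏_{p∈Ps}(1 − 1/p) e^{−log D/log z} + D`.
[cite: FriedlanderIwaniecOpera2010, Cor. 6.10] [cite: FriedlanderGranville1992, §3 (3.2)] -/
theorem abs_apSiftedCount_sub_le :
    ∃ C : ℝ, 0 < C ∧ ∀ (Ps : Finset ℕ) (z : ℝ), (∀ p ∈ Ps, p.Prime) → (∀ p ∈ Ps, (p : ℝ) < z) →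
      ∀ (e : ℕ), 0 < e → (∀ p ∈ Ps, ¬ p ∣ e) → ∀ (X₁ y c : ℕ) (D : ℝ), 2 ≤ z → z ≤ D →
        |(apSiftedCount X₁ y e c Ps : ℝ) - (y : ℝ) / e * sieveDensity Ps| ≤
          C * ((y : ℝ) / e) * sieveDensity Ps * Real.exp (-(Real.log D / Real.log z)) + D := by
  obtain ⟨C, hC, h⟩ := SieveSequence.fundamental_lemma_uniform_holds 1 (Real.exp 5)
  refine ⟨C, hC, fun Ps z hPs hPz e he hPe X₁ y c D hz hzD => ?_⟩
  set A := apSeq X₁ y e c Ps with hA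
  have hsize : A.size ((X₁ + y : ℕ) : ℝ) = (y : ℝ) / e := rfl
  have hsize0 : 0 ≤ A.size ((X₁ + y : ℕ) : ℝ) := by rw [hsize]; positivity
  have h1 := h A (hasSieveDimension_psRecip Ps) ((X₁ + y : ℕ) : ℝ) z D hz hzD hsize0
  rw [apSeq_sifted hPs hPz, hsize, apSeq_densityProduct hPs hPz] at h1
  refine h1.trans (add_le_add (le_of_eq (by ring)) ?_)
  calc ∑ d ∈ (primesProdBelow z).divisors.filter (fun d : ℕ => (d : ℝ) ≤ D), |A.remainder d _|
      ≤ ∑ d ∈ (primesProdBelow z).divisors.filter (fun d : ℕ => (d : ℝ) ≤ D), (1 : ℝ) :=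
        sum_le_sum fun d hd => abs_apSeq_remainder_le hPs he hPe X₁ y c
          ((squarefree_primesProdBelow z).squarefree_of_dvd (Nat.dvd_of_mem_divisors (mem_filter.1 hd).1))
    _ = #((primesProdBelow z).divisors.filter (fun d : ℕ => (d : ℝ) ≤ D)) := by simp
    _ ≤ D := BFI.card_divisors_filter_le _ (by linarith)

/-! ## The shifted sifted interval and its inner counts -/

/-- `G = shiftedSiftedCount y T U = #{1 ≤ r ≤ y : p ∤ r ∀ p ∈ T, p ∤ r + 1 ∀ p ∈ U}` — Friedlander–
Granville's `G(h) = #{1 ≤ r ≤ y : (r, a) = (r + h, P_b(z)) = 1}` with `h = 1`, `T` = the primes of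
`a`, `U` = the primes of `P`. [cite: FriedlanderGranville1992, §3 Proposition 1 (definition of G(h))] -/
def shiftedSiftedCount (y : ℕ) (T U : Finset ℕ) : ℕ :=
  #{r ∈ Icc 1 y | (∀ p ∈ T, ¬ p ∣ r) ∧ ∀ p ∈ U, ¬ p ∣ r + 1}

/-- The inner count of Legendre's expansion over the window: `#{1 ≤ r ≤ y : e ∣ r + 1, p ∤ r ∀ p ∈ T,
p ∤ r + 1 ∀ p ∈ U}`. [folklore] -/
def innerCount (y : ℕ) (T U : Finset ℕ) (e : ℕ) : ℕ :=
  #{r ∈ Icc 1 y | e ∣ r + 1 ∧ (∀ p ∈ T, ¬ p ∣ r) ∧ ∀ p ∈ U, ¬ p ∣ r + 1}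

/-- If `e > y + 1` the inner count vanishes (`e ∣ r + 1` with `2 ≤ r + 1 ≤ y + 1 < e` is impossible). [folklore] -/
theorem innerCount_eq_zero {y e : ℕ} (T U : Finset ℕ) (he : y + 1 < e) : innerCount y T U e = 0 := by
  rw [innerCount, card_eq_zero, filter_eq_empty_iff]
  rintro r hr ⟨hdvd, -, -⟩
  rw [mem_Icc] at hr
  have := Nat.le_of_dvd (Nat.succ_pos r) hdvd
  omega

/-- **The Chinese-remainder shift.** If `σ ≥ 1` is divisible by every `p ∈ T` and `σ − 1` is
divisible by `e` and by every `p ∈ U`, then `r ↦ r + σ` carries the inner count to a sifted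
progression segment: `innerCount y T U e = apSiftedCount σ y e 0 (T ∪ U)`. [folklore] -/
theorem innerCount_eq_apSiftedCount {y e σ : ℕ} {T U : Finset ℕ} (hσ : 1 ≤ σ)
    (hσT : ∀ p ∈ T, p ∣ σ) (hσU : ∀ p ∈ U, p ∣ σ - 1) (hσe : e ∣ σ - 1) :
    innerCount y T U e = apSiftedCount σ y e 0 (T ∪ U) := by
  unfold innerCount apSiftedCount
  refine card_nbij' (fun r ↦ r + σ) (fun m ↦ m - σ) (fun r hr ↦ ?_) (fun m hm ↦ ?_)
    (fun r _ ↦ by simp) (fun m hm ↦ ?_)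
  · simp only [mem_coe, mem_filter, mem_Icc] at hr
    obtain ⟨⟨hr1, hry⟩, hdvd, hT, hU⟩ := hr
    simp only [mem_coe, mem_filter, mem_Ioc, mem_union]
    have hsplit : r + σ = (r + 1) + (σ - 1) := by omega
    refine ⟨⟨by omega, by omega⟩, ?_, ?_⟩
    · rw [Nat.modEq_zero_iff_dvd, hsplit]
      exact (Nat.dvd_add_left hσe).2 hdvd
    · rintro p (hp | hp)
      · rw [Nat.dvd_add_left (hσT p hp)]; exact hT p hp
      · rw [hsplit, Nat.dvd_add_left (hσU p hp)]; exact hU p hp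
  · simp only [mem_coe, mem_filter, mem_Ioc, mem_union] at hm
    obtain ⟨⟨hm1, hmy⟩, hmod, hall⟩ := hm
    simp only [mem_coe, mem_filter, mem_Icc]
    have hsplit : m = (m - σ + 1) + (σ - 1) := by omega
    have hsplit' : m = (m - σ) + σ := by omega
    refine ⟨⟨by omega, by omega⟩, ?_, fun p hp ↦ ?_, fun p hp ↦ ?_⟩
    · rw [Nat.modEq_zero_iff_dvd, hsplit, Nat.dvd_add_left hσe] at hmod
      exact hmod
    · have := hall p (Or.inl hp)
      rw [hsplit', Nat.dvd_add_left (hσT p hp)] at this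
      exact this
    · have := hall p (Or.inr hp)
      rw [hsplit, Nat.dvd_add_left (hσU p hp)] at this
      exact this
  · simp only [mem_coe, mem_filter, mem_Ioc] at hm
    have : σ ≤ m := hm.1.1.le
    simp only
    omega

/-- Existence of the shift: for finite sets of primes `T`, `U` and a modulus `e ≥ 1` such that no
prime of `T` lies in `U` or divides `e`, there is `σ ≥ 1` with `p ∣ σ` (`p ∈ T`), `p ∣ σ − 1`
(`p ∈ U`) and `e ∣ σ − 1` (Chinese remainder theorem). [folklore] -/
theorem exists_shift {T U : Finset ℕ} (hT : ∀ p ∈ T, p.Prime) (hU : ∀ p ∈ U, p.Prime)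
    (hTU : ∀ p ∈ T, p ∉ U) {e : ℕ} (he : 0 < e) (hTe : ∀ p ∈ T, ¬ p ∣ e) :
    ∃ σ : ℕ, 1 ≤ σ ∧ (∀ p ∈ T, p ∣ σ) ∧ (∀ p ∈ U, p ∣ σ - 1) ∧ e ∣ σ - 1 := by
  set A : ℕ := ∏ p ∈ T, p with hA
  set B : ℕ := e * ∏ p ∈ U, p with hB
  have hA0 : 0 < A := prod_pos fun p hp ↦ (hT p hp).pos
  have hB0 : 0 < B := Nat.mul_pos he (prod_pos fun p hp ↦ (hU p hp).pos)
  have hcop : A.Coprime B := by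
    rw [hA, hB]
    refine Nat.Coprime.prod_left fun p hp ↦ Nat.Coprime.mul_right ?_ ?_
    · exact (Nat.Prime.coprime_iff_not_dvd (hT p hp)).2 (hTe p hp)
    · refine Nat.Coprime.prod_right fun q hq ↦ (Nat.coprime_primes (hT p hp) (hU q hq)).2 ?_
      rintro rfl; exact hTU p hp hq
  set σ₀ : ℕ := (Nat.chineseRemainder hcop 0 1 : ℕ) with hσ₀
  have h0 : σ₀ ≡ 0 [MOD A] := (Nat.chineseRemainder hcop 0 1).prop.1
  have h1 : σ₀ ≡ 1 [MOD B] := (Nat.chineseRemainder hcop 0 1).prop.2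
  refine ⟨σ₀ + A * B, by nlinarith, fun p hp ↦ ?_, fun p hp ↦ ?_, ?_⟩
  · have hpA : p ∣ A := dvd_prod_of_mem _ hp
    have hAσ : A ∣ σ₀ := (Nat.modEq_zero_iff_dvd.1 h0)
    exact dvd_add (hpA.trans hAσ) (hpA.trans (dvd_mul_right A B))
  · have hpB : p ∣ B := (dvd_prod_of_mem _ hp).trans (dvd_mul_left _ e)
    have hB1 : B ∣ σ₀ + A * B - 1 := by
      have h2 : 1 ≡ σ₀ + A * B [MOD B] := by
        have : σ₀ + A * B ≡ σ₀ + 0 [MOD B] :=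
          Nat.ModEq.add_left σ₀ (Nat.modEq_zero_iff_dvd.2 (dvd_mul_left B A))
        rw [add_zero] at this
        exact (h1.symm.trans this.symm)
      exact (Nat.modEq_iff_dvd' (by nlinarith)).1 h2
    exact hpB.trans hB1
  · have heB : e ∣ B := dvd_mul_right e _
    have hB1 : B ∣ σ₀ + A * B - 1 := by
      have h2 : 1 ≡ σ₀ + A * B [MOD B] := by
        have : σ₀ + A * B ≡ σ₀ + 0 [MOD B] :=
          Nat.ModEq.add_left σ₀ (Nat.modEq_zero_iff_dvd.2 (dvd_mul_left B A))
        rw [add_zero] at this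
        exact (h1.symm.trans this.symm)
      exact (Nat.modEq_iff_dvd' (by nlinarith)).1 h2
    exact heB.trans hB1

/-! ## Legendre's expansion over the window and its exact truncation -/

/-- **Legendre over the window**: for a finite set `S` of primes,
`shiftedSiftedCount y T (U ∪ S) = ∑_{t ⊆ S} (−1)^{#t} innerCount y T U (∏ t)`. [folklore] -/
theorem shiftedSiftedCount_union_eq_sum (y : ℕ) (T U S : Finset ℕ) (hS : ∀ p ∈ S, p.Prime) :
    (shiftedSiftedCount y T (U ∪ S) : ℝ) =
      ∑ t ∈ S.powerset, (-1 : ℝ) ^ #t * (innerCount y T U (∏ p ∈ t, p) : ℝ) := by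
  classical
  unfold shiftedSiftedCount innerCount
  simp_rw [Finset.card_filter, Nat.cast_sum, Nat.cast_ite, Nat.cast_one, Nat.cast_zero]
  simp_rw [mul_sum]
  rw [sum_comm]
  refine sum_congr rfl fun r _ ↦ ?_
  have key := indicator_sifted_eq_sum S hS (r + 1)
  by_cases hTU : (∀ p ∈ T, ¬ p ∣ r) ∧ ∀ p ∈ U, ¬ p ∣ r + 1
  · have lhs : (if ((∀ p ∈ T, ¬ p ∣ r) ∧ ∀ p ∈ U ∪ S, ¬ p ∣ r + 1) then (1 : ℝ) else 0) =
        if (∀ p ∈ S, ¬ p ∣ r + 1) then (1 : ℝ) else 0 := by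
      by_cases hSr : ∀ p ∈ S, ¬ p ∣ r + 1
      · rw [if_pos hSr, if_pos]
        exact ⟨hTU.1, fun p hp ↦ (mem_union.1 hp).elim (hTU.2 p) (hSr p)⟩
      · rw [if_neg hSr, if_neg]
        exact fun h ↦ hSr fun p hp ↦ h.2 p (mem_union_right _ hp)
    rw [lhs, key]
    refine sum_congr rfl fun t _ ↦ ?_
    by_cases hdvd : (∏ p ∈ t, p) ∣ r + 1
    · rw [if_pos hdvd, if_pos ⟨hdvd, hTU.1, hTU.2⟩]
    · rw [if_neg hdvd, if_neg (fun h ↦ hdvd h.1)]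
  · rw [if_neg (fun h ↦ hTU ⟨h.1, fun p hp ↦ h.2 p (mem_union_left _ hp)⟩)]
    symm
    refine sum_eq_zero fun t _ ↦ ?_
    rw [if_neg (fun h ↦ hTU ⟨h.2.1, h.2.2⟩), mul_zero]

/-- **The truncated Legendre sum**: `∑_{t ⊆ S, #t ≤ k} (−1)^{#t}/∏t = W(S) + (−1)^k g_k(S)`. [folklore] -/
theorem sum_trunc_eq (S : Finset ℕ) (k : ℕ) :
    ∑ t ∈ S.powerset, (if ¬ k < #t then (-1 : ℝ) ^ #t * ∏ p ∈ t, (p : ℝ)⁻¹ else 0) =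
      sieveDensity S + (-1) ^ k * gTail S k := by
  rw [sieveDensity_eq_sum, gTail, mul_sum, ← sum_add_distrib]
  refine sum_congr rfl fun t _ ↦ ?_
  by_cases hkt : k < #t
  · rw [if_neg (not_not_intro hkt), if_pos hkt]
    have hk2 : ((-1 : ℝ) ^ k) ^ 2 = 1 := by
      rw [← pow_mul, mul_comm, pow_mul, neg_one_sq, one_pow]
    have : (-1 : ℝ) ^ (#t + k + 1) = (-1) ^ #t * (-1) ^ k * (-1) := by
      rw [pow_add, pow_add, pow_one]
    rw [this]
    linear_combination ((-1 : ℝ) ^ #t * ∏ p ∈ t, (p : ℝ)⁻¹) * hk2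
  · rw [if_pos hkt, if_neg hkt, mul_zero, add_zero]

/-- `∑_{t ⊆ S} ∏_{p ∈ t} 1/p = ∏_{p ∈ S} (1 + 1/p)`. [folklore] -/
theorem sum_powerset_prod_inv (S : Finset ℕ) :
    ∑ t ∈ S.powerset, ∏ p ∈ t, (p : ℝ)⁻¹ = ∏ p ∈ S, (1 + (p : ℝ)⁻¹) := by
  rw [prod_one_add]

/-! ## The window–parity estimate -/

/-- **The window–parity estimate for a shifted sifted interval** (Friedlander–Granville 1992,
§3 Proposition 1, in the parity form of Soundararajan 2007, Lecture 3, Exercise 11). There is an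
absolute `C > 0` such that: for finite sets of primes `T, U` below `z ≥ 2`, no prime of `T` in `U`,
a finite set of primes `S` all `≥ z` and all `> w ≥ 1`, and `y, k` with `y + 1 ≤ w^{k+1}`, for every
`D ≥ z`, writing `G = shiftedSiftedCount y T (U ∪ S)`, `V = W(T ∪ U)`, `W = W(S)`:
`|G − y V (W + (−1)^k g_k(S))| ≤ C e^{−log D/log z} y V ∏_{p∈S}(1 + 1/p) + (k+1)(#S+1)^k D`.
Proof: Legendre over `S` (`shiftedSiftedCount_union_eq_sum`); the `t` with `#t > k` have
`∏t > w^{k+1} ≥ y + 1` and contribute nothing (`innerCount_eq_zero`); each remaining inner count is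
a sifted progression segment after the shift of `exists_shift` (`innerCount_eq_apSiftedCount`) and
is `(y/∏t) V` up to the error of `abs_apSiftedCount_sub_le`; the truncated main terms add up to
`y V (W + (−1)^k g_k)` (`sum_trunc_eq`). [cite: FriedlanderGranville1992, §3 Proposition 1]
[cite: Soundararajan2007Distribution, Lecture 3 Exercise 11] -/
theorem abs_shiftedSiftedCount_window_sub_le :
    ∃ C : ℝ, 0 < C ∧ ∀ (T U S : Finset ℕ) (z w : ℝ) (y k : ℕ) (D : ℝ),
      (∀ p ∈ T, p.Prime) → (∀ p ∈ U, p.Prime) → (∀ p ∈ S, p.Prime) →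
      (∀ p ∈ T, (p : ℝ) < z) → (∀ p ∈ U, (p : ℝ) < z) → (∀ p ∈ S, z ≤ (p : ℝ)) →
      (∀ p ∈ T, p ∉ U) → 1 ≤ w → (∀ p ∈ S, w < p) → ((y : ℝ) + 1 ≤ w ^ (k + 1)) →
      2 ≤ z → z ≤ D →
        |(shiftedSiftedCount y T (U ∪ S) : ℝ) -
            y * sieveDensity (T ∪ U) * (sieveDensity S + (-1) ^ k * gTail S k)| ≤
          C * Real.exp (-(Real.log D / Real.log z)) * y * sieveDensity (T ∪ U) *
              ∏ p ∈ S, (1 + (p : ℝ)⁻¹) +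
            (k + 1) * (#S + 1) ^ k * D := by
  classical
  obtain ⟨C, hC, hcore⟩ := abs_apSiftedCount_sub_le
  refine ⟨C, hC, fun T U S z w y k D hT hU hS hTz hUz hSz hTU hw hSw hyw hz hzD ↦ ?_⟩
  have hw0 : 0 < w := by linarith
  have hD0 : 0 ≤ D := by linarith
  -- the set `T ∪ U` of small primes
  have hTUp : ∀ p ∈ T ∪ U, p.Prime := fun p hp ↦ (mem_union.1 hp).elim (hT p) (hU p)
  have hTUz : ∀ p ∈ T ∪ U, (p : ℝ) < z := fun p hp ↦ (mem_union.1 hp).elim (hTz p) (hUz p)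
  set V : ℝ := sieveDensity (T ∪ U) with hVdef
  obtain ⟨hV0, hV1⟩ := sieveDensity_nonneg_le_one (T ∪ U)
  set ex : ℝ := Real.exp (-(Real.log D / Real.log z)) with hexdef
  have hex0 : 0 < ex := Real.exp_pos _
  -- the inner counts as functions of `t ⊆ S`
  set f : Finset ℕ → ℝ := fun t ↦ (innerCount y T U (∏ p ∈ t, p) : ℝ) with hfdef
  -- (1) vanishing beyond `k`
  have hvan : ∀ t ∈ S.powerset, k < #t → f t = 0 := by
    intro t ht hkt
    have htS : t ⊆ S := mem_powerset.1 ht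
    have hne : t.Nonempty := card_pos.1 (by omega)
    have h1 : w ^ #t < ∏ p ∈ t, (p : ℝ) := by
      rw [← prod_const]
      exact prod_lt_prod_of_nonempty (fun p _ ↦ hw0) (fun p hp ↦ hSw p (htS hp)) hne
    have h2 : w ^ (k + 1) ≤ w ^ #t := pow_le_pow_right₀ hw hkt
    have h3 : ((y + 1 : ℕ) : ℝ) < ((∏ p ∈ t, p : ℕ) : ℝ) := by
      rw [Nat.cast_prod]; push_cast; linarith
    have h4 : y + 1 < ∏ p ∈ t, p := by exact_mod_cast h3
    simp only [hfdef, innerCount_eq_zero T U h4, Nat.cast_zero]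
  -- (2) the inner counts for `#t ≤ k`
  have happrox : ∀ t ∈ S.powerset,
      |f t - (y : ℝ) / ((∏ p ∈ t, p : ℕ) : ℝ) * V| ≤
        C * ((y : ℝ) / ((∏ p ∈ t, p : ℕ) : ℝ)) * V * ex + D := by
    intro t ht
    have htS : t ⊆ S := mem_powerset.1 ht
    have htp : ∀ p ∈ t, p.Prime := fun p hp ↦ hS p (htS hp)
    set e : ℕ := ∏ p ∈ t, p with hedef
    have he0 : 0 < e := prod_pos fun p hp ↦ (htp p hp).pos
    -- no prime of `T ∪ U` divides `e` (the primes of `e` are `≥ z`, those of `T ∪ U` are `< z`)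
    have hTUe : ∀ p ∈ T ∪ U, ¬ p ∣ e := by
      intro p hp hpe
      have hpp := hTUp p hp
      rw [hedef, (Nat.prime_iff.1 hpp).dvd_finsetProd_iff] at hpe
      obtain ⟨q, hq, hpq⟩ := hpe
      have hqq := htp q hq
      have : p = q := (Nat.prime_dvd_prime_iff_eq hpp hqq).1 hpq
      subst this
      have h1 := hTUz p hp
      have h2 := hSz p (htS hq)
      linarith
    obtain ⟨σ, hσ1, hσT, hσU, hσe⟩ := exists_shift hT hU hTU he0 (fun p hp ↦ hTUe p (mem_union_left _ hp))
    have hinner : innerCount y T U e = apSiftedCount σ y e 0 (T ∪ U) :=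
      innerCount_eq_apSiftedCount hσ1 hσT hσU hσe
    have := hcore (T ∪ U) z hTUp hTUz e he0 hTUe σ y 0 D hz hzD
    simp only [hfdef]
    rw [← hedef, hinner]
    exact this
  -- (3) Legendre and the truncation
  have hLeg := shiftedSiftedCount_union_eq_sum y T U S hS
  have hmain : (shiftedSiftedCount y T (U ∪ S) : ℝ) -
      y * V * (sieveDensity S + (-1) ^ k * gTail S k) =
      ∑ t ∈ S.powerset, (if ¬ k < #t then
        (-1 : ℝ) ^ #t * (f t - (y : ℝ) / ((∏ p ∈ t, p : ℕ) : ℝ) * V) else 0) := by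
    rw [hLeg, ← sum_trunc_eq S k, mul_sum, ← sum_sub_distrib]
    refine sum_congr rfl fun t ht ↦ ?_
    by_cases hkt : k < #t
    · rw [if_neg (not_not_intro hkt), if_neg (not_not_intro hkt), mul_zero, sub_zero,
        show (innerCount y T U (∏ p ∈ t, p) : ℝ) = f t from rfl, hvan t ht hkt, mul_zero]
    · rw [if_pos hkt, if_pos hkt]
      have hP : ∏ p ∈ t, (p : ℝ)⁻¹ = (((∏ p ∈ t, p : ℕ) : ℝ))⁻¹ := by
        rw [Nat.cast_prod, prod_inv_distrib]
      rw [hP, show (innerCount y T U (∏ p ∈ t, p) : ℝ) = f t from rfl, div_eq_mul_inv]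
      ring
  rw [hmain]
  -- (4) summing the errors
  have hcount := card_filter_card_le_le S k
  calc |∑ t ∈ S.powerset, (if ¬ k < #t then
          (-1 : ℝ) ^ #t * (f t - (y : ℝ) / ((∏ p ∈ t, p : ℕ) : ℝ) * V) else 0)|
      ≤ ∑ t ∈ S.powerset, |(if ¬ k < #t then
          (-1 : ℝ) ^ #t * (f t - (y : ℝ) / ((∏ p ∈ t, p : ℕ) : ℝ) * V) else 0)| :=
        abs_sum_le_sum_abs _ _
    _ ≤ ∑ t ∈ S.powerset, (C * ((y : ℝ) / ((∏ p ∈ t, p : ℕ) : ℝ)) * V * ex +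
          (if ¬ k < #t then D else 0)) := by
        refine sum_le_sum fun t ht ↦ ?_
        by_cases hkt : k < #t
        · rw [if_neg (not_not_intro hkt), if_neg (not_not_intro hkt), abs_zero, add_zero]
          have : 0 ≤ (y : ℝ) / ((∏ p ∈ t, p : ℕ) : ℝ) := by positivity
          positivity
        · rw [if_pos hkt, if_pos hkt, abs_mul, abs_pow, abs_neg, abs_one, one_pow, one_mul]
          exact happrox t ht
    _ = C * ex * y * V * ∑ t ∈ S.powerset, ∏ p ∈ t, (p : ℝ)⁻¹ +
          (#{t ∈ S.powerset | ¬ k < #t} : ℝ) * D := by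
        rw [sum_add_distrib, mul_sum, ← sum_filter, sum_const, nsmul_eq_mul]
        congr 1
        refine sum_congr rfl fun t _ ↦ ?_
        rw [Nat.cast_prod, prod_inv_distrib, div_eq_mul_inv]
        ring
    _ ≤ C * ex * y * V * ∏ p ∈ S, (1 + (p : ℝ)⁻¹) + (k + 1) * (#S + 1) ^ k * D := by
        rw [sum_powerset_prod_inv]
        have h2 : (#{t ∈ S.powerset | ¬ k < #t} : ℝ) * D ≤ (k + 1) * (#S + 1) ^ k * D :=
          mul_le_mul_of_nonneg_right hcount hD0
        linarith
    _ = C * Real.exp (-(Real.log D / Real.log z)) * y * sieveDensity (T ∪ U) *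
          ∏ p ∈ S, (1 + (p : ℝ)⁻¹) + (k + 1) * (#S + 1) ^ k * D := by rw [hexdef, hVdef]

/-- **Even `k`: the shifted interval is richly sifted** — `G ≥ y V W(S) (1 + e_{k+1}(S)) − Err`
under the hypotheses of `abs_shiftedSiftedCount_window_sub_le` (`W e_{k+1} ≤ g_k`,
`MaierMatrix.sieveDensity_mul_eSymm_le_gTail`). This is the analogue, for the residue-restricted
count, of Friedlander–Granville's (3.1)/(5.1) with `ω(M) > e^{-γ}`.
[cite: FriedlanderGranville1992, §3 Proposition 1, (3.1)] [cite: Soundararajan2007Distribution, Lecture 3 Exercise 11] -/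
theorem shiftedSiftedCount_window_ge_of_even :
    ∃ C : ℝ, 0 < C ∧ ∀ (T U S : Finset ℕ) (z w : ℝ) (y k : ℕ) (D : ℝ),
      (∀ p ∈ T, p.Prime) → (∀ p ∈ U, p.Prime) → (∀ p ∈ S, p.Prime) →
      (∀ p ∈ T, (p : ℝ) < z) → (∀ p ∈ U, (p : ℝ) < z) → (∀ p ∈ S, z ≤ (p : ℝ)) →
      (∀ p ∈ T, p ∉ U) → 1 ≤ w → (∀ p ∈ S, w < p) → ((y : ℝ) + 1 ≤ w ^ (k + 1)) →
      2 ≤ z → z ≤ D → Even k →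
        y * sieveDensity (T ∪ U) * sieveDensity S * (1 + eSymm S (k + 1)) -
            (C * Real.exp (-(Real.log D / Real.log z)) * y * sieveDensity (T ∪ U) *
                ∏ p ∈ S, (1 + (p : ℝ)⁻¹) + (k + 1) * (#S + 1) ^ k * D) ≤
          shiftedSiftedCount y T (U ∪ S) := by
  obtain ⟨C, hC, h⟩ := abs_shiftedSiftedCount_window_sub_le
  refine ⟨C, hC, fun T U S z w y k D hT hU hS hTz hUz hSz hTU hw hSw hyw hz hzD hk ↦ ?_⟩
  have h1 := h T U S z w y k D hT hU hS hTz hUz hSz hTU hw hSw hyw hz hzD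
  rw [hk.neg_one_pow, one_mul, abs_le] at h1
  have h2 := sieveDensity_mul_eSymm_le_gTail S k
  have h0 : (0 : ℝ) ≤ y * sieveDensity (T ∪ U) :=
    mul_nonneg (Nat.cast_nonneg y) (sieveDensity_nonneg_le_one (T ∪ U)).1
  nlinarith [h1.1, mul_le_mul_of_nonneg_left h2 h0]

/-- **Odd `k`: the shifted interval is poorly sifted** — `G ≤ y V W(S) (1 − e_{k+1}(S)) + Err`
under the hypotheses of `abs_shiftedSiftedCount_window_sub_le`. The analogue of Friedlander–
Granville's construction for (1.6) (`ω(M) < e^{-γ}`).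
[cite: FriedlanderGranville1992, §3 Proposition 1 and §1 (1.6)] [cite: Soundararajan2007Distribution, Lecture 3 Exercise 11] -/
theorem shiftedSiftedCount_window_le_of_odd :
    ∃ C : ℝ, 0 < C ∧ ∀ (T U S : Finset ℕ) (z w : ℝ) (y k : ℕ) (D : ℝ),
      (∀ p ∈ T, p.Prime) → (∀ p ∈ U, p.Prime) → (∀ p ∈ S, p.Prime) →
      (∀ p ∈ T, (p : ℝ) < z) → (∀ p ∈ U, (p : ℝ) < z) → (∀ p ∈ S, z ≤ (p : ℝ)) →
      (∀ p ∈ T, p ∉ U) → 1 ≤ w → (∀ p ∈ S, w < p) → ((y : ℝ) + 1 ≤ w ^ (k + 1)) →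
      2 ≤ z → z ≤ D → Odd k →
        (shiftedSiftedCount y T (U ∪ S) : ℝ) ≤
          y * sieveDensity (T ∪ U) * sieveDensity S * (1 - eSymm S (k + 1)) +
            (C * Real.exp (-(Real.log D / Real.log z)) * y * sieveDensity (T ∪ U) *
                ∏ p ∈ S, (1 + (p : ℝ)⁻¹) + (k + 1) * (#S + 1) ^ k * D) := by
  obtain ⟨C, hC, h⟩ := abs_shiftedSiftedCount_window_sub_le
  refine ⟨C, hC, fun T U S z w y k D hT hU hS hTz hUz hSz hTU hw hSw hyw hz hzD hk ↦ ?_⟩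
  have h1 := h T U S z w y k D hT hU hS hTz hUz hSz hTU hw hSw hyw hz hzD
  rw [hk.neg_one_pow, abs_le] at h1
  have h2 := sieveDensity_mul_eSymm_le_gTail S k
  have h0 : (0 : ℝ) ≤ y * sieveDensity (T ∪ U) :=
    mul_nonneg (Nat.cast_nonneg y) (sieveDensity_nonneg_le_one (T ∪ U)).1
  nlinarith [h1.2, mul_le_mul_of_nonneg_left h2 h0]

end Literature.NumberTheory.Sieve.ShiftedWindowSieve
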